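import Summits.BirchSwinnertonDyer.BirchSwinnertonDyer.Theorems.EisensteinPrimesCasselsTateDecisionRankOne
import Summits.BirchSwinnertonDyer.Rank1Residual.X11b.ChaPairsMinimality
import HarnessLib

/-!
# Row A2 (X1b, type B, `r_an = 1`), the one NOUNIT class — SECOND MEMBER, SECOND ROAD: `BSD(371522j2, 3)` through the Cassels–Tate
# flat-cell door by a second `3`-descent on the DUAL side (cell `bsd-eis`, seat `bsd-eis-k5-p4` g5, JOB DESIGN #60 «CT2ISO-371522j»;
# THEOREMS ONLY — per-pair instrument certificate feeding READ binders of a GZK + Cassels–Tate kernel door; nothing booked here)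

HONEST FRAMING (cell `bsd-eis`, run/shared/lean/pub/bsd-eis/; files `pub/bsd-eis/k5-p4-g5/`, NOTE-371522j-CT2ISO.md §10). Twin of
`EisensteinPrimesA2SecondDescent371522j1.lean` (p573117) on the isogenous member `j2 = [1,0,0,−13378662,139148270804]` with an
INDEPENDENT input construction: the first φ-descent on j2 in Cohen–Pazuki form over `K′ = ℚ(√1293)` (`h = 1`; `S^{(φ)}(j1) ≅ ℤ/3 = Ш(j1)[φ]`,
Mordell–Weil part `0` — `α(P₂)` is a cube), the φ-covering `C_{u_a} : −24p³ + (2589q − 3r)p² − 93096pq² + 1115859q³ + 3879q²r + 2229132r³ = 0`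
of class `a` (Jacobian `j1`; `u_a = 863 − 24√1293`, a unit), Creutz–Miller's second φ̂-descent on it (flex field `ℚ[t]/(t³ − t − 8)` of
discriminant `−431` — THE cubic field of discriminant `−431`, which exists because `3 ∣ h(−431) = 21`; `F(S,3)` of dimension `7`,
`S = {2,3,431}`; local images certified; EXACTLY `9 = #S^{(φ̂)}(j2)` classes, as the theory forces) and nine explicit minimal cubics with
Jacobian `j2` (e.g. `D′₁ = 13x³ − 12x²y − 53x²w − 121xy² + 385xyw − 216xw² + 100y³ − 258y²w + 10yw² + 138w³`, `disc = Δ_min(j2) =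
−2⁴·431⁹`; Jacobian on two engines; ELS on two engines), representing the classes `d, d ± c ∈ Ш(j2)[3] ∖ Ш(j2)[φ̂]` over `a`; the second
`3`-descent (x10 route-C9 engines `ninedesc_e2.py` r3.1 ‖ `ninedesc.gp` r4, byte-identical, kit j291214 ‖ j291215) is INCONSISTENT
⇒ `Sel^{(3)}(D′_i/ℚ) = ∅` ⇒ `[D′_i] ∉ 3Ш(j2)`, in particular `[D′_i] ≠ 0` — the hypothesis `hwit`. The window `#Ш(j2)[3] ∣ 9` is READ
from `0 → Ш(j2)[φ̂] → Ш(j2)[3] → Ш(j1)[φ]` with `#Ш(j2)[φ̂] = 3 = #Ш(j1)[φ]` (isogchi ‖ isogcft ‖ ct2iso); `#Ш_an(j2) = 9` (Cremona allbsd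
= PARI leg). **PUBLISHED facts BY NAME:** `hGZK`, `hCT` only. What this is NOT: not a class theorem; not new mathematics; `BSDp` is
Miller's per-prime formula. References: [CreutzMiller2012] Lemma 2.3, Thm 5.1, Thm 6.2; Creutz, Math. Comp. 83 (2014) §7;
[Cassels1962ArithmeticIV]; [SilvermanAEC2009] X.4.2, X.4.14; [Miller2011LMS] §1, Def. 1.1; Cremona `ecdata` class 371522j.
-/

set_option autoImplicit false
set_option linter.dupNamespace false

noncomputable section

open scoped Classical AddSubgroup

open WeierstrassCurve Literature.NumberTheory.EllipticCurves
  Literature.NumberTheory.EllipticCurves.ModularForms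
  Literature.NumberTheory.EllipticCurves.Rank1Residual
  Literature.NumberTheory.EllipticCurves.Rank1Residual.Typed
  Summit.BirchSwinnertonDyer.BirchSwinnertonDyer.Theorems

namespace Summit.BirchSwinnertonDyer.BirchSwinnertonDyer.Theorems.A2SecondDescent371522j2

/-- `371522j2 = [1, 0, 0, -13378662, 139148270804]` is elliptic (`Δ = −2⁴·431⁹ ≠ 0`). [cite: SilvermanAEC2009, III.1] -/
theorem isElliptic_371522j2 : (⟨1, 0, 0, (-13378662), 139148270804⟩ : WeierstrassCurve ℚ).IsElliptic :=
  Summit.BirchSwinnertonDyer.Rank1Residual.X11b.isElliptic_of_discOf_ne_zero 1 0 0 (-13378662) 139148270804 (by decide +kernel)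

/-- **X1b NOUNIT INSTANCE, SECOND MEMBER, DUAL-SIDE SECOND-`3`-DESCENT ROAD — `BSD(371522j2, 3)`** from Gross–Zagier–Kolyvagin (`hGZK`) and Cassels–Tate
(`hCT`) through the flat-cell door `CasselsTateDecision.bsdp_of_val_two_of_exists_torsion_not_mem_range`, given the READS on
`371522j2`: `r_an = 1`, `#Ш_an = 9` (`ord₃ = 2`), the first-descent window `#Ш[3] ∣ 9`, and ONE `3`-torsion class of `Ш` that is not a
`3`-rd multiple — the second `3`-descent certificate `Sel^{(3)}(D′_i/ℚ) = ∅` on the dual-side cubics (JOB DESIGN #60, NOTE §10). No Iwasawa theory, no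
`p`-adic height, no upper-half theorem. Nothing booked; `BSDp` only.
[cite: CreutzMiller2012, Lemma 2.3] [cite: SilvermanAEC2009, Thm. X.4.2 and X.4.14] [cite: Miller2011LMS, §1 and Def. 1.1] -/
theorem bsdp_371522j2_at_three_of_secondDescent (hCT : exists_casselsTate_pairing (K := ℚ))
    (hGZK : rank_eq_analyticRank_of_analyticRank_le_one)
    (W : WeierstrassCurve ℚ) [W.IsElliptic] (hW : W = ⟨1, 0, 0, (-13378662), 139148270804⟩)
    (hr : W.analyticRank = 1) {q : ℚ} (hq : shaAn W = (q : ℂ)) (hv : padicValRat 3 q = 2)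
    (hdvd : Nat.card (W.sha[((3 : ℕ) : ℤ)]) ∣ 3 ^ 2)
    (hwit : ∃ a : W.sha, (3 : ℕ) • a = 0 ∧ a ∉ (nsmulAddMonoidHom (α := W.sha) 3).range) : BSDp W 3 := by
  subst hW
  exact CasselsTateDecision.bsdp_of_val_two_of_exists_torsion_not_mem_range _ 3 hCT hGZK (by omega) hdvd hwit hq hv

/-- **The same on the row's shape `r_an = 1 → BSDp W 3`** for the record curve, modulo GZK + CT and the three reads.
[cite: Miller2011LMS, §1 and Def. 1.1] -/
theorem rankOne_bsdp_371522j2_of_secondDescent (hCT : exists_casselsTate_pairing (K := ℚ))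
    (hGZK : rank_eq_analyticRank_of_analyticRank_le_one)
    (W : WeierstrassCurve ℚ) [W.IsElliptic] (hW : W = ⟨1, 0, 0, (-13378662), 139148270804⟩)
    {q : ℚ} (hq : shaAn W = (q : ℂ)) (hv : padicValRat 3 q = 2)
    (hdvd : Nat.card (W.sha[((3 : ℕ) : ℤ)]) ∣ 3 ^ 2)
    (hwit : ∃ a : W.sha, (3 : ℕ) • a = 0 ∧ a ∉ (nsmulAddMonoidHom (α := W.sha) 3).range) :
    W.analyticRank = 1 → BSDp W 3 :=
  fun hr ↦ bsdp_371522j2_at_three_of_secondDescent hCT hGZK W hW hr hq hv hdvd hwit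

end Summit.BirchSwinnertonDyer.BirchSwinnertonDyer.Theorems.A2SecondDescent371522j2

end
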